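import Mathlib.AlgebraicTopology.SingularHomology.Basic
import Mathlib.AlgebraicTopology.SingularHomology.HomotopyInvariance
import Mathlib.AlgebraicTopology.SingularHomology.HomologyZero
import Mathlib.AlgebraicTopology.SimplicialSet.Homology.Basic
import Mathlib.Algebra.Category.ModuleCat.Colimits
import Mathlib.Algebra.Category.ModuleCat.Abelian
import Mathlib.Topology.Homotopy.Equiv
import Summits.Ventures.HodgeRepro2.HostAPI.Util.ForallBinderLint

noncomputable section

open CategoryTheory Limits AlgebraicTopology Simplicial Opposite

universe u v

namespace HostAPI.Carriers.AlgebraicTopology.SingularHomology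

variable (R : Type v) [CommRing R] (M : Type v) [AddCommGroup M] [Module R M]
variable {X Y Z : Type u} [TopologicalSpace X] [TopologicalSpace Y] [TopologicalSpace Z]

variable (X) in

abbrev SingularSimplex (n : ℕ) : Type u := (TopCat.toSSet.obj (TopCat.of X)) _⦋n⦌

namespace SingularSimplex

variable {n : ℕ}

def toContinuousMap : SingularSimplex X n ≃ C(stdSimplex ℝ (Fin (n + 1)), X) :=
  TopCat.toSSetObjEquiv (TopCat.of X) (op ⦋n⦌)

def face (i : Fin (n + 2)) (σ : SingularSimplex X (n + 1)) : SingularSimplex X n :=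
  (TopCat.toSSet.obj (TopCat.of X)).δ i σ

def map (f : C(X, Y)) (σ : SingularSimplex X n) : SingularSimplex Y n :=
  (TopCat.toSSet.map (TopCat.ofHom f)).app (op ⦋n⦌) σ

@[simp]
lemma map_id (σ : SingularSimplex X n) : σ.map (ContinuousMap.id X) = σ := by
  change (TopCat.toSSet.map (𝟙 (TopCat.of X))).app (op ⦋n⦌) σ = σ
  rw [CategoryTheory.Functor.map_id]
  rfl

lemma map_comp (f : C(X, Y)) (g : C(Y, Z)) (σ : SingularSimplex X n) :
    σ.map (g.comp f) = (σ.map f).map g := by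
  change (TopCat.toSSet.map (TopCat.ofHom f ≫ TopCat.ofHom g)).app (op ⦋n⦌) σ = _
  rw [CategoryTheory.Functor.map_comp]
  rfl

@[simp]
lemma face_map (f : C(X, Y)) (i : Fin (n + 2)) (σ : SingularSimplex X (n + 1)) :
    (σ.map f).face i = (σ.face i).map f :=
  (SSet.δ_naturality_apply (TopCat.toSSet.map (TopCat.ofHom f)) i σ).symm

end SingularSimplex

variable (X) in

abbrev singularChainComplex : ChainComplex (ModuleCat.{max u v} R) ℕ :=
  ((singularChainComplexFunctor (ModuleCat.{max u v} R)).obj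
    (ModuleCat.of R (ULift.{u} M))).obj (TopCat.of X)

namespace singularChainComplex

variable {R M} {n : ℕ}

def singleₗ (σ : SingularSimplex X n) : M →ₗ[R] (singularChainComplex R M X).X n :=
  ((TopCat.toSSet.obj (TopCat.of X)).ιChainComplex
      (R := ModuleCat.of R (ULift.{u} M)) σ).hom.comp
    ULift.moduleEquiv.symm.toLinearMap

def single (σ : SingularSimplex X n) (m : M) : (singularChainComplex R M X).X n :=
  singleₗ (R := R) σ m

@[simp]
lemma singleₗ_apply (σ : SingularSimplex X n) (m : M) :
    singleₗ (R := R) σ m = single (R := R) σ m := rfl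

lemma single_eq_ιChainComplex (σ : SingularSimplex X n) (m : M) :
    single (R := R) σ m =
      ((TopCat.toSSet.obj (TopCat.of X)).ιChainComplex
        (R := ModuleCat.of R (ULift.{u} M)) σ).hom (ULift.up m) := rfl

lemma d_single (σ : SingularSimplex X (n + 1)) (m : M) :
    (singularChainComplex R M X).d (n + 1) n (single (R := R) σ m) =
      ∑ i : Fin (n + 2), ((-1 : R) ^ (i : ℕ)) • single (R := R) (σ.face i) m := by
  have h := congr(($((TopCat.toSSet.obj (TopCat.of X)).ιChainComplex_d
    (R := ModuleCat.of R (ULift.{u} M)) σ)).hom (ULift.up m))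
  simp only [ModuleCat.hom_comp, LinearMap.comp_apply, ModuleCat.hom_sum, ModuleCat.hom_zsmul,
    LinearMap.coe_sum, Finset.sum_apply, LinearMap.smul_apply] at h
  refine h.trans (Finset.sum_congr rfl fun i _ ↦ ?_)
  rw [← Int.cast_smul_eq_zsmul R, Int.cast_pow, Int.cast_neg, Int.cast_one]
  rfl

lemma hom_ext {T : ModuleCat.{max u v} R} {φ ψ : (singularChainComplex R M X).X n ⟶ T}
    (h : ∀ (σ : SingularSimplex X n) (m : M), φ (single (R := R) σ m) = ψ (single (R := R) σ m)) :
    φ = ψ := by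
  refine SSet.chainComplex_hom_ext (fun σ ↦ ?_)
  ext ⟨m⟩
  exact h σ m

variable (R M) in

abbrev map (f : C(X, Y)) : singularChainComplex R M X ⟶ singularChainComplex R M Y :=
  ((singularChainComplexFunctor (ModuleCat.{max u v} R)).obj
    (ModuleCat.of R (ULift.{u} M))).map (TopCat.ofHom f)

@[simp]
lemma map_f_single (f : C(X, Y)) (σ : SingularSimplex X n) (m : M) :
    (map R M f).f n (single (R := R) σ m) = single (R := R) (σ.map f) m :=
  congr(($(SSet.ι_chainComplexMap_f (f := TopCat.toSSet.map (TopCat.ofHom f))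
    (R := ModuleCat.of R (ULift.{u} M)) (x := σ))).hom (ULift.up m))

@[simp]
lemma map_id : map R M (ContinuousMap.id X) = 𝟙 _ :=
  CategoryTheory.Functor.map_id _ _

lemma map_comp (f : C(X, Y)) (g : C(Y, Z)) :
    map R M (g.comp f) = map R M f ≫ map R M g :=
  CategoryTheory.Functor.map_comp _ _ _

end singularChainComplex

variable (X) in

abbrev singularHomology (n : ℕ) : ModuleCat.{max u v} R :=
  (singularChainComplex R M X).homology n

namespace singularHomology

abbrev map (f : C(X, Y)) (n : ℕ) : singularHomology R M X n ⟶ singularHomology R M Y n :=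
  HomologicalComplex.homologyMap (singularChainComplex.map R M f) n

@[simp]
lemma map_id (n : ℕ) : map R M (ContinuousMap.id X) n = 𝟙 _ := by
  rw [map, singularChainComplex.map_id, HomologicalComplex.homologyMap_id]

@[reassoc]
lemma map_comp (f : C(X, Y)) (g : C(Y, Z)) (n : ℕ) :
    map R M (g.comp f) n = map R M f n ≫ map R M g n := by
  rw [map, singularChainComplex.map_comp, HomologicalComplex.homologyMap_comp]

lemma map_eq_of_homotopic {f g : C(X, Y)} (h : f.Homotopic g) (n : ℕ) :
    map R M f n = map R M g n :=
  TopCat.Homotopy.congr_homologyMap_singularChainComplexFunctor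
    (f := TopCat.ofHom f) (g := TopCat.ofHom g) h.some _ n

@[simps]
def mapIso (e : X ≃ₜ Y) (n : ℕ) : singularHomology R M X n ≅ singularHomology R M Y n where
  hom := map R M e n
  inv := map R M e.symm n
  hom_inv_id := by
    rw [← map_comp]
    exact (congrArg (map R M · n) (by ext x; exact e.symm_apply_apply x)).trans (map_id R M n)
  inv_hom_id := by
    rw [← map_comp]
    exact (congrArg (map R M · n) (by ext x; exact e.apply_symm_apply x)).trans (map_id R M n)

@[simps]
def isoOfHomotopyEquiv (e : ContinuousMap.HomotopyEquiv X Y) (n : ℕ) :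
    singularHomology R M X n ≅ singularHomology R M Y n where
  hom := map R M e.toFun n
  inv := map R M e.invFun n
  hom_inv_id := by rw [← map_comp, map_eq_of_homotopic R M e.left_inv, map_id]
  inv_hom_id := by rw [← map_comp, map_eq_of_homotopic R M e.right_inv, map_id]

variable (X) in

def ε : singularHomology R M X 0 ⟶ ModuleCat.of R (ULift.{u} M) :=
  TopCat.singularHomology₀ε (TopCat.of X) (ModuleCat.of R (ULift.{u} M))

theorem isIso_ε_of_pathConnectedSpace [PathConnectedSpace X] : IsIso (ε R M X) :=
  inferInstanceAs (IsIso (TopCat.singularHomology₀ε (TopCat.of X) _))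

end singularHomology

theorem isZero_singularHomology_of_totallyDisconnectedSpace [TotallyDisconnectedSpace X] {n : ℕ}
    (hn : n ≠ 0) : IsZero (singularHomology R M X n) :=
  isZero_singularHomologyFunctor_of_totallyDisconnectedSpace _ n _ (TopCat.of X) hn

theorem isZero_singularHomology_of_subsingleton [Subsingleton X] {n : ℕ} (hn : n ≠ 0) :
    IsZero (singularHomology R M X n) :=
  isZero_singularHomology_of_totallyDisconnectedSpace R M hn

end HostAPI.Carriers.AlgebraicTopology.SingularHomology
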